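import Mathlib.Analysis.Convex.Function
import Summits.HubbardSuperconductivity.HubbardSuperconductivity.Theorems.TwSourcedCondensation.Negative.SourceResponseStructure
import Summits.HubbardSuperconductivity.HubbardSuperconductivity.Theorems.ThermalWedgeTwSeededEnsembleEquivalenceRSourcedPressureBasics

/-!
# Crux `TwSeededEnsembleEquivalenceR` (stmt-HubbardSuperconductivity-15581), line `cold-floor-collapse`
# (slug `Sketch`, skeleton v6/v7) — ENGINE-FACING NORMAL FORM OF THE REGULATED PHYSICS STUB DEEP-UNIQ′

Support file (`--supports stmt-HubbardSuperconductivity-15581`; sorry-free; no definition).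

Skeleton v6 of the line (lead c2) implements the card's floor: at the cold slice `β = e^{a/U}` every maximiser
of the AHM functional `h ↦ q(μ,h) − h²/g` over `|h| ≤ 13g+1` is a DEEP source, `|h| ≥ e^{−a/(4U)}`
(`stub_optimiserFloor`, landed, from the condensation item stmt-1697), so the uniqueness of the optimal source
modulus is needed only among DEEP maximisers — the registered stub `stub_sourcedColdUniqDeep` (DEEP-UNIQ′).
Its physical content is the STRICT CONCAVITY of the cold sourced limit pressure in the squared source `s = h²`
on the REGULATED range `s ∈ [e^{−a/(2U)}, (13g+1)²]` only (source-as-infrared-regulator regime: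
`U log(1/s) ≤ a/2`, `√s / T ≥ e^{3a/(4U)}`), which is what a convergent expansion two source-derivatives deep
would establish for small `U` on top of the elementary `U = 0` statement. This file proves, kernel-checked:

* `usc_stub_sourcedColdUniqDeep_of_deepStrictConcavity` — **DEEP-SCONC ⟹ DEEP-UNIQ′** with DEEP-UNIQ′ the
  registered signature of `stub_sourcedColdUniqDeep` VERBATIM, where DEEP-SCONC has the same quantifier prefix and
  asserts `StrictConcaveOn ℝ [e^{−a/(2U)}, (13g+1)²] (s ↦ q μ √s)` for every `μ ∈ (μ₁,μ₂)`.
  Proof: evenness in `h` (gauge rotation, `partitionFn_dWaveSourceTorus_neg`) and the `8√2`-Lipschitz bound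
  (`abs_sourcedPressure_sub_le`) pass to the limit, so `q μ h = q μ √(h²)` and the payoff is bounded above on the
  box; two DEEP maximisers with `h² ≠ h₀²` would be beaten strictly by the (again deep) source `√((h²+h₀²)/2)`.

Compared with the whole-box normal form `usc_stub_sourcedColdUniq_of_strictConcavity` (…RUniqOfStrictConcavity,
route seat 0), no concavity is asked on `s < e^{−a/(2U)}` — the BCS-critical / Landau regime `s ≲ T²` and the
normal state `s = 0` are outside the hypothesis. [folklore composition]
-/

set_option linter.dupNamespace false

namespace Summit.HubbardSuperconductivity.HubbardSuperconductivity.Theorems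

open Matrix Set Literature.MathematicalPhysics.QuantumLattice
open Summit.HubbardSuperconductivity.HubbardSuperconductivity.Theorems.TwSourcedCondensation.Negative
open Summit.HubbardSuperconductivity.HubbardSuperconductivity.Theorems.TwSeededEnsembleEquivalenceR.ColdFloorLine
open scoped ComplexOrder

noncomputable section

/-- Squares of DEEP points of `[-R, R]` (`e^{−a/(4U)} ≤ |h|`) lie in `[e^{−a/(2U)}, R²]`. [folklore] -/
theorem uscd_sq_mem_Icc_of_deep {R h a U : ℝ} (hh : h ∈ Set.Icc (-R) R)
    (hdeep : Real.exp (-(a / (4 * U))) ≤ |h|) :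
    h ^ 2 ∈ Set.Icc (Real.exp (-(a / (2 * U)))) (R ^ 2) := by
  refine ⟨?_, ?_⟩
  · have he : Real.exp (-(a / (2 * U))) = Real.exp (-(a / (4 * U))) ^ 2 := by
      rw [sq, ← Real.exp_add]; congr 1; ring
    rw [he, ← sq_abs h]
    exact pow_le_pow_left₀ (Real.exp_pos _).le hdeep 2
  · have habs : |h| ≤ R := abs_le.mpr hh
    have hR : 0 ≤ R := (abs_nonneg h).trans habs
    nlinarith [abs_nonneg h, sq_abs h]

/-- **Engine-facing normal form of DEEP-UNIQ′ (`stub_sourcedColdUniqDeep` of line `Sketch`, skeleton v6,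
crux stmt-HubbardSuperconductivity-15581).** If, on every compact window `[μ₁,μ₂] ⊂ (−4,0)`, for all small
exponents `a ≤ a₁` (seed floor `K′`, `U ≤ U₀`), every pointwise thermodynamic limit `q` of the sourced torus
pressure at `β = e^{a/U}` on `[μ₁,μ₂] × [−(13g+1), 13g+1]` is STRICTLY CONCAVE in the squared source on the
REGULATED range, `StrictConcaveOn ℝ [e^{−a/(2U)}, (13g+1)²] (s ↦ q μ √s)` for `μ ∈ (μ₁,μ₂)`, then the modulus
of the DEEP maximisers (`e^{−a/(4U)} ≤ |h|`) of `h ↦ q μ h − h²/g` on `|h| ≤ 13g+1` is unique — the registered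
signature of `stub_sourcedColdUniqDeep`, verbatim. [folklore composition] -/
theorem usc_stub_sourcedColdUniqDeep_of_deepStrictConcavity :
    (∀ (μ₁ μ₂ : ℝ), -4 < μ₁ → μ₁ < μ₂ → μ₂ < 0 → ∃ a₁ : ℝ, 0 < a₁ ∧ ∀ a ∈ Set.Ioc (0 : ℝ) a₁,
      ∃ K' U₀ : ℝ, 0 < K' ∧ 0 < U₀ ∧ ∀ U ∈ Set.Ioc (0 : ℝ) U₀, ∀ g ∈ Set.Icc (K' * U) (1 / 10),
        ∀ q : ℝ → ℝ → ℝ,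
          (∀ μ ∈ Set.Icc μ₁ μ₂, ∀ h ∈ Set.Icc (-(13 * g + 1)) (13 * g + 1), ∀ κ : ℝ, 0 < κ →
            ∃ L₀ : ℕ, ∀ (L : ℕ) [NeZero L], L₀ ≤ L →
              |Real.log (Matrix.partitionFn (Real.exp (a / U)) (dWaveSourceTorus L U μ h)).re /
                  (Real.exp (a / U) * (L : ℝ) ^ 2) - q μ h| ≤ κ) →
          ∀ μ ∈ Set.Ioo μ₁ μ₂,
            StrictConcaveOn ℝ (Set.Icc (Real.exp (-(a / (2 * U)))) ((13 * g + 1) ^ 2))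
              (fun s : ℝ => q μ (Real.sqrt s))) →
    ∀ (μ₁ μ₂ : ℝ), -4 < μ₁ → μ₁ < μ₂ → μ₂ < 0 → ∃ a₁ : ℝ, 0 < a₁ ∧ ∀ a ∈ Set.Ioc (0 : ℝ) a₁,
      ∃ K' U₀ : ℝ, 0 < K' ∧ 0 < U₀ ∧ ∀ U ∈ Set.Ioc (0 : ℝ) U₀, ∀ g ∈ Set.Icc (K' * U) (1 / 10),
        ∀ q : ℝ → ℝ → ℝ,
          (∀ μ ∈ Set.Icc μ₁ μ₂, ∀ h ∈ Set.Icc (-(13 * g + 1)) (13 * g + 1), ∀ κ : ℝ, 0 < κ →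
            ∃ L₀ : ℕ, ∀ (L : ℕ) [NeZero L], L₀ ≤ L →
              |Real.log (Matrix.partitionFn (Real.exp (a / U)) (dWaveSourceTorus L U μ h)).re /
                  (Real.exp (a / U) * (L : ℝ) ^ 2) - q μ h| ≤ κ) →
          ∀ μ ∈ Set.Ioo μ₁ μ₂, ∃ hstar : ℝ, ∀ h ∈ Set.Icc (-(13 * g + 1)) (13 * g + 1),
            Real.exp (-(a / (4 * U))) ≤ |h| →
            q μ h - h ^ 2 / g =
                sSup ((fun h' : ℝ => q μ h' - h' ^ 2 / g) '' Set.Icc (-(13 * g + 1)) (13 * g + 1)) →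
              h = hstar ∨ h = -hstar := by
  intro hS μ₁ μ₂ h4 h12 h0
  obtain ⟨a₁, ha₁, hA⟩ := hS μ₁ μ₂ h4 h12 h0
  refine ⟨a₁, ha₁, fun a ha => ?_⟩
  obtain ⟨K', U₀, hK', hU₀, hB⟩ := hA a ha
  refine ⟨K', U₀, hK', hU₀, fun U hU g hg q hq μ hμ => ?_⟩
  have hsc := hB U hU g hg q hq μ hμ
  set R : ℝ := 13 * g + 1 with hR_def
  have hg0 : 0 < g := lt_of_lt_of_le (mul_pos hK' hU.1) hg.1
  have hR : 0 < R := by rw [hR_def]; positivity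
  set β : ℝ := Real.exp (a / U) with hβ_def
  have hβ : 0 < β := Real.exp_pos _
  have hμ' : μ ∈ Set.Icc μ₁ μ₂ := ⟨hμ.1.le, hμ.2.le⟩
  -- sequence form (side `n + 1`) of the limit at `μ`, any admissible source
  have hseq : ∀ h ∈ Set.Icc (-R) R, ∀ κ : ℝ, 0 < κ → ∃ N : ℕ, ∀ n, N ≤ n →
      |Real.log (partitionFn β (dWaveSourceTorus (n + 1) U μ h)).re / (β * ((n + 1 : ℕ) : ℝ) ^ 2) -
          q μ h| ≤ κ := by
    intro h hh κ hκ
    obtain ⟨L₁, hL₁⟩ := hq μ hμ' h hh κ hκ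
    exact ⟨L₁, fun n hn => hL₁ (n + 1) (by omega)⟩
  -- evenness of the limit in `h`
  have heven : ∀ h ∈ Set.Icc (-R) R, q μ (-h) = q μ h := by
    intro h hh
    have hnh : -h ∈ Set.Icc (-R) R := ⟨by linarith [hh.2], by linarith [hh.1]⟩
    have h00 : |q μ (-h) - q μ h| ≤ 0 := by
      refine cfb_abs_sub_le_of_limits (hseq (-h) hnh) (hseq h hh) fun n => ?_
      rw [partitionFn_dWaveSourceTorus_neg, sub_self, abs_zero]
    have := abs_nonneg (q μ (-h) - q μ h)
    linarith [abs_le.mp h00]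
  have habs : ∀ h ∈ Set.Icc (-R) R, q μ h = q μ (Real.sqrt (h ^ 2)) := by
    intro h hh
    rw [Real.sqrt_sq_eq_abs]
    rcases le_or_gt 0 h with h0' | h0'
    · rw [abs_of_nonneg h0']
    · rw [abs_of_neg h0', heven h hh]
  -- the payoff is bounded above on the source interval (Lipschitz bound `8√2` inherited from finite volume)
  have h0mem : (0 : ℝ) ∈ Set.Icc (-R) R := ⟨by linarith, hR.le⟩
  have hLip : ∀ h ∈ Set.Icc (-R) R, |q μ h - q μ 0| ≤ 8 * Real.sqrt 2 * |h - 0| := by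
    intro h hh
    refine cfb_abs_sub_le_of_limits (hseq h hh) (hseq 0 h0mem) fun n => ?_
    have := abs_sourcedPressure_sub_le (n + 1) U μ hβ h 0
    simpa using this
  have hbdd : BddAbove ((fun h' : ℝ => q μ h' - h' ^ 2 / g) '' Set.Icc (-R) R) := by
    refine ⟨q μ 0 + 8 * Real.sqrt 2 * R, ?_⟩
    rintro _ ⟨h', hh', rfl⟩
    have h1 := abs_le.mp (hLip h' hh')
    have h2 : |h' - 0| ≤ R := by rw [sub_zero]; exact abs_le.mpr hh'
    have h3 : 0 ≤ h' ^ 2 / g := by positivity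
    have h4 : 8 * Real.sqrt 2 * |h' - 0| ≤ 8 * Real.sqrt 2 * R :=
      mul_le_mul_of_nonneg_left h2 (by positivity)
    linarith [h1.2]
  by_cases hex : ∃ h₀ ∈ Set.Icc (-R) R, Real.exp (-(a / (4 * U))) ≤ |h₀| ∧
      q μ h₀ - h₀ ^ 2 / g = sSup ((fun h' : ℝ => q μ h' - h' ^ 2 / g) '' Set.Icc (-R) R)
  · obtain ⟨h₀, hh₀, hdeep₀, hmax₀⟩ := hex
    refine ⟨|h₀|, fun h hh hdeep hmax => ?_⟩
    suffices habs_eq : |h| = |h₀| by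
      rcases le_or_gt 0 h with h0' | h0'
      · left; rw [← habs_eq, abs_of_nonneg h0']
      · right; rw [← habs_eq, abs_of_neg h0']; ring
    by_contra hne
    have hs : h ^ 2 ≠ h₀ ^ 2 := by
      intro e
      apply hne
      rw [← Real.sqrt_sq_eq_abs, ← Real.sqrt_sq_eq_abs, e]
    have hs1 : h ^ 2 ∈ Set.Icc (Real.exp (-(a / (2 * U)))) (R ^ 2) := uscd_sq_mem_Icc_of_deep hh hdeep
    have hs2 : h₀ ^ 2 ∈ Set.Icc (Real.exp (-(a / (2 * U)))) (R ^ 2) := uscd_sq_mem_Icc_of_deep hh₀ hdeep₀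
    have key := hsc.2 hs1 hs2 hs (show (0 : ℝ) < 1 / 2 by norm_num) (show (0 : ℝ) < 1 / 2 by norm_num)
      (by norm_num)
    simp only [smul_eq_mul] at key
    -- the midpoint source
    set m : ℝ := Real.sqrt (1 / 2 * h ^ 2 + 1 / 2 * h₀ ^ 2) with hm_def
    have havg_nn : 0 ≤ 1 / 2 * h ^ 2 + 1 / 2 * h₀ ^ 2 := by positivity
    have havg_le : 1 / 2 * h ^ 2 + 1 / 2 * h₀ ^ 2 ≤ R ^ 2 := by linarith [hs1.2, hs2.2]
    have hm_nn : 0 ≤ m := Real.sqrt_nonneg _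
    have hm_le : m ≤ R := by
      rw [hm_def, ← Real.sqrt_sq hR.le]
      exact Real.sqrt_le_sqrt havg_le
    have hm_mem : m ∈ Set.Icc (-R) R := ⟨by linarith, hm_le⟩
    have hm_sq : m ^ 2 = 1 / 2 * h ^ 2 + 1 / 2 * h₀ ^ 2 := by
      rw [hm_def, Real.sq_sqrt havg_nn]
    have hle : q μ m - m ^ 2 / g ≤ sSup ((fun h' : ℝ => q μ h' - h' ^ 2 / g) '' Set.Icc (-R) R) :=
      le_csSup hbdd ⟨m, hm_mem, rfl⟩
    rw [← habs h hh, ← habs h₀ hh₀] at key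
    -- key : 1/2 * q μ h + 1/2 * q μ h₀ < q μ m
    rw [hm_sq] at hle
    have e1 : (1 / 2 * h ^ 2 + 1 / 2 * h₀ ^ 2) / g = 1 / 2 * (h ^ 2 / g) + 1 / 2 * (h₀ ^ 2 / g) := by
      field_simp
    rw [e1] at hle
    linarith
  · exact ⟨0, fun h hh hdeep hmax => (hex ⟨h, hh, hdeep, hmax⟩).elim⟩

end

end Summit.HubbardSuperconductivity.HubbardSuperconductivity.Theorems
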